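import Mathlib
import Summits.Ventures.PercRepro2.ZMeanProof
import Summits.Ventures.PercRepro2.PocketConn
import Summits.Ventures.PercRepro2.PocketLaw
import Summits.Ventures.PercRepro2.PocketRowPD
import Summits.Ventures.PercRepro2.PocketRowT
import Summits.Ventures.PercRepro2.PocketMasses

/-!
# The closed form of `HMFc` in a root-only pocket

Substituting the factorised masses (`PocketMasses`) and `X̂` (`PocketRowT.Xhat_pocket`) into
`HMFc = 2 P(Q) [(P(PD, a₁↔o) + P(PD, a₂↔o)) (M₂ + Δ_T) − X̂ P(PD)] − gap · marginC` and using
`P(Q_P) = π₀ + π₁ + π₂` (`prob_QPocket_split`) gives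

`HMFc = 2 · P(Q_P) · Z₁ · π₀ · [π₂ · β₂ + π₁ · β₁]`,
`β₂ = A_L¹ (B_H¹ − B_L¹) − Z₁ Y_T`, `β₁ = −A_H¹ (B_H¹ − B_L¹) − Z₁ Y_T′`

(`HMFc_pocket`): the root-only-pocket theorem's identity.  Its sign is the two BHK inequalities
on the outside graph `G₁` (`β₁, β₂ ≥ 0`), stated here as hypotheses (`HMF_pocket_of_beta`).
-/

namespace Summit.Ventures.PercRepro2

namespace PocketConn

variable {V : Type*} {E : Type*} [Fintype V] [DecidableEq V]

variable {ends : E → Sym2 V} {P : Finset V} {a₁ a₂ a₃ : V}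

/-- `Q_out` is symmetric in the roots. -/
lemma QOutside_comm :
    QOutside ends (↑P : Set V) a₂ a₁ = QOutside ends (↑P : Set V) a₁ a₂ := by
  ext ω
  simp only [QOutside, Set.mem_setOf_eq]
  exact ⟨fun h h' => h (conn_symm h'), fun h h' => h (conn_symm h')⟩

/-- `Q_P` is symmetric in the roots. -/
lemma QPocket_comm :
    QPocket ends (↑P : Set V) a₂ a₁ = QPocket ends (↑P : Set V) a₁ a₂ := by
  ext ω
  simp only [QPocket, Set.mem_setOf_eq]
  exact ⟨fun h h' => h (conn_symm h'), fun h h' => h (conn_symm h')⟩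

/-- The T′ pocket factor `π₁` written with the roots in the standard order. -/
lemma pi_comm :
    {ω : Config E | ¬ Conn ends (restrict (touches ends (↑P : Set V)) ω) a₂ a₁ ∧
        Conn ends (restrict (touches ends (↑P : Set V)) ω) a₃ a₁} =
      {ω | ¬ Conn ends (restrict (touches ends (↑P : Set V)) ω) a₁ a₂ ∧
        Conn ends (restrict (touches ends (↑P : Set V)) ω) a₃ a₁} := by
  ext ω
  simp only [Set.mem_setOf_eq]
  exact ⟨fun h => ⟨fun h' => h.1 (conn_symm h'), h.2⟩, fun h => ⟨fun h' => h.1 (conn_symm h'), h.2⟩⟩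

omit [Fintype V] [DecidableEq V] in
/-- `avoidAll a₂ {a₁}` is `Q`. -/
lemma avoidAll_eq_compl_connEvent :
    avoidAll ends a₂ {a₁} = (connEvent ends a₁ a₂)ᶜ := by
  ext ω
  simp only [avoidAll, Set.mem_setOf_eq, Finset.mem_singleton, forall_eq, Set.mem_compl_iff,
    mem_connEvent]
  exact ⟨fun h h' => h (conn_symm h'), fun h h' => h (conn_symm h')⟩

section Prob

variable [Fintype E] [DecidableEq E] {R : Type*} [CommRing R]

/-- `outMass` is symmetric in the roots. -/
lemma outMass_comm (p : E → R) (x v : V) :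
    outMass p ends P a₂ a₁ x v = outMass p ends P a₁ a₂ x v := by
  simp only [outMass, QOutside_comm]

/-- `P(Q, x ↔ v) = P(Q_P) · P(Q₁, x ↔₁ v)` for `x, v` outside the pocket. -/
theorem prob_Q_inter_conn (p : E → R) (hP : IsPocket ends (↑P : Set V) a₁ a₂) (h1 : a₁ ∉ P)
    (h2 : a₂ ∉ P) {x v : V} (hx : x ∉ P) (hv : v ∉ P) :
    prob p ((connEvent ends a₁ a₂)ᶜ ∩ connEvent ends x v) =
      prob p (QPocket ends (↑P : Set V) a₁ a₂) * outMass p ends P a₁ a₂ x v := by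
  have e : (connEvent ends a₁ a₂)ᶜ ∩ connEvent ends x v =
      QPocket ends (↑P : Set V) a₁ a₂ ∩ (QOutside ends (↑P : Set V) a₁ a₂ ∩
        {ω | Conn ends (restrict (touches ends (↑P : Set V))ᶜ ω) x v}) := by
    rw [compl_connEvent_eq_QPocket_inter_QOutside hP (by simpa using h1) (by simpa using h2)]
    ext ω
    simp only [Set.mem_inter_iff, mem_connEvent, QPocket, QOutside, Set.mem_setOf_eq, and_assoc]
    constructor
    · rintro ⟨hQP, hQ1, hc⟩
      have hQ : ¬ Conn ends ω a₁ a₂ := by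
        rw [conn_roots_iff hP (by simpa using h1) (by simpa using h2)]
        exact not_or.2 ⟨hQP, hQ1⟩
      exact ⟨hQP, hQ1,
        (conn_iff_conn_restrict hP hQ (by simpa using hx) (by simpa using hv)).1 hc⟩
    · rintro ⟨hQP, hQ1, hc⟩
      have hQ : ¬ Conn ends ω a₁ a₂ := by
        rw [conn_roots_iff hP (by simpa using h1) (by simpa using h2)]
        exact not_or.2 ⟨hQP, hQ1⟩
      exact ⟨hQP, hQ1,
        (conn_iff_conn_restrict hP hQ (by simpa using hx) (by simpa using hv)).2 hc⟩
  rw [e, outMass]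
  exact prob_pocket_mul_outside p ends (↑P : Set V) (fun σ => ¬ Conn ends σ a₁ a₂)
    (fun σ => ¬ Conn ends σ a₁ a₂ ∧ Conn ends σ x v)

/-- `P(T) = π₂ · Z₁`. -/
theorem prob_TEvent_pocket (p : E → R) (hP : IsPocket ends (↑P : Set V) a₁ a₂) (h1 : a₁ ∉ P)
    (h2 : a₂ ∉ P) (h3 : a₃ ∈ P) :
    prob p (TEvent ends a₁ a₂ a₃) =
      prob p {ω | ¬ Conn ends (restrict (touches ends (↑P : Set V)) ω) a₁ a₂ ∧
          Conn ends (restrict (touches ends (↑P : Set V)) ω) a₃ a₂} *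
        prob p (QOutside ends (↑P : Set V) a₁ a₂) := by
  have h := prob_Q_root_mul p hP (by simpa using h1) (by simpa using h2) (Or.inr rfl)
    (by simpa using h3) (fun _ => True)
  have e : (connEvent ends a₁ a₂)ᶜ ∩ connEvent ends a₂ a₃ ∩
      {ω : Config E | (fun _ => True) (restrict (touches ends (↑P : Set V))ᶜ ω)} =
      TEvent ends a₁ a₂ a₃ := by
    ext ω
    simp only [Set.mem_inter_iff, Set.mem_compl_iff, mem_connEvent, Set.mem_setOf_eq, TEvent,
      and_true]
    exact ⟨fun h => ⟨fun h' => h.1 (conn_symm h'), h.2⟩, fun h => ⟨fun h' => h.1 (conn_symm h'), h.2⟩⟩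
  rw [e] at h
  rw [h]
  congr 1
  simp only [QOutside, and_true]

/-- **`P(Q_P) = π₀ + π₁ + π₂`**: on `Q_P` the pocket vertex `a₃` reaches no root, `a₁` only, or
`a₂` only. -/
theorem prob_QPocket_split (p : E → R) :
    prob p (QPocket ends (↑P : Set V) a₁ a₂) =
      prob p (PDPocket ends P a₁ a₂ a₃) +
        prob p {ω | ¬ Conn ends (restrict (touches ends (↑P : Set V)) ω) a₁ a₂ ∧
          Conn ends (restrict (touches ends (↑P : Set V)) ω) a₃ a₁} +
        prob p {ω | ¬ Conn ends (restrict (touches ends (↑P : Set V)) ω) a₁ a₂ ∧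
          Conn ends (restrict (touches ends (↑P : Set V)) ω) a₃ a₂} := by
  set ωP : Config E → Config E := fun ω => restrict (touches ends (↑P : Set V)) ω with hωP
  have e1 := prob_inter_add_prob_inter_compl p (QPocket ends (↑P : Set V) a₁ a₂)
    {ω | Conn ends (ωP ω) a₃ a₂}
  have e2 := prob_inter_add_prob_inter_compl p
    (QPocket ends (↑P : Set V) a₁ a₂ ∩ {ω | Conn ends (ωP ω) a₃ a₂}ᶜ) {ω | Conn ends (ωP ω) a₃ a₁}
  have s1 : QPocket ends (↑P : Set V) a₁ a₂ ∩ {ω | Conn ends (ωP ω) a₃ a₂} =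
      {ω | ¬ Conn ends (restrict (touches ends (↑P : Set V)) ω) a₁ a₂ ∧
        Conn ends (restrict (touches ends (↑P : Set V)) ω) a₃ a₂} := by
    ext ω
    simp only [QPocket, Set.mem_inter_iff, Set.mem_setOf_eq, hωP]
  have s2 : QPocket ends (↑P : Set V) a₁ a₂ ∩ {ω | Conn ends (ωP ω) a₃ a₂}ᶜ ∩
      {ω | Conn ends (ωP ω) a₃ a₁} =
      {ω | ¬ Conn ends (restrict (touches ends (↑P : Set V)) ω) a₁ a₂ ∧
        Conn ends (restrict (touches ends (↑P : Set V)) ω) a₃ a₁} := by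
    ext ω
    simp only [QPocket, Set.mem_inter_iff, Set.mem_compl_iff, Set.mem_setOf_eq, hωP]
    constructor
    · rintro ⟨⟨hQ, _⟩, h31⟩
      exact ⟨hQ, h31⟩
    · rintro ⟨hQ, h31⟩
      exact ⟨⟨hQ, fun h32 => hQ (conn_trans (conn_symm h31) h32)⟩, h31⟩
  have s3 : QPocket ends (↑P : Set V) a₁ a₂ ∩ {ω | Conn ends (ωP ω) a₃ a₂}ᶜ ∩
      {ω | Conn ends (ωP ω) a₃ a₁}ᶜ = PDPocket ends P a₁ a₂ a₃ := by
    ext ω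
    simp only [QPocket, PDPocket, Set.mem_inter_iff, Set.mem_compl_iff, Set.mem_setOf_eq, hωP]
    exact ⟨fun h => ⟨h.1.1, h.2, h.1.2⟩, fun h => ⟨⟨h.1, h.2.2⟩, h.2.1⟩⟩
  rw [s1] at e1
  rw [s2, s3] at e2
  linear_combination e1.symm + e2.symm

end Prob

section Field

variable [Fintype E] [DecidableEq E] {R : Type*} [Field R] [LinearOrder R]
  [IsStrictOrderedRing R]

/-- **The closed form of `HMFc` in a root-only pocket.**  With `q = P(Q_P)`, `Z = Z₁`,
`π₀, π₁, π₂` the pocket type probabilities, `A_x = P(Q₁, a_x ↔₁ o)`, `B_x = P(Q₁, a_x ↔₁ b)` and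
`Y_T, Y_T′` the outside mean-field sums:
`HMFc = 2 q Z π₀ [π₂ (A_L (B_H − B_L) − Z Y_T) + π₁ (−A_H (B_H − B_L) − Z Y_T′)]`. -/
theorem HMFc_pocket (p : E → R) (hp : IsProbVec p) (hP : IsPocket ends (↑P : Set V) a₁ a₂)
    (h12 : a₁ ≠ a₂) (h1 : a₁ ∉ P) (h2 : a₂ ∉ P) {o b : V} (ho : o ∉ P) (hb : b ∉ P)
    (h3 : a₃ ∈ P) :
    HMFc p ends o a₁ a₂ a₃ b =
      2 * prob p (QPocket ends (↑P : Set V) a₁ a₂) * prob p (QOutside ends (↑P : Set V) a₁ a₂) *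
        prob p (PDPocket ends P a₁ a₂ a₃) *
        (prob p {ω | ¬ Conn ends (restrict (touches ends (↑P : Set V)) ω) a₁ a₂ ∧
            Conn ends (restrict (touches ends (↑P : Set V)) ω) a₃ a₂} *
          (outMass p ends P a₁ a₂ a₁ o *
              (outMass p ends P a₁ a₂ a₂ b - outMass p ends P a₁ a₂ a₁ b) -
            prob p (QOutside ends (↑P : Set V) a₁ a₂) *
              ∑ W₂ : Finset V,
                prob p {ω | ¬ Conn ends (restrict (touches ends (↑P : Set V))ᶜ ω) a₁ a₂ ∧
                  cluster ends (restrict (touches ends (↑P : Set V))ᶜ ω) a₂ = (↑W₂ : Set V)} *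
                  outTermT p ends P W₂ o a₁ b) +
          prob p {ω | ¬ Conn ends (restrict (touches ends (↑P : Set V)) ω) a₁ a₂ ∧
            Conn ends (restrict (touches ends (↑P : Set V)) ω) a₃ a₁} *
          (-(outMass p ends P a₁ a₂ a₂ o *
              (outMass p ends P a₁ a₂ a₂ b - outMass p ends P a₁ a₂ a₁ b)) -
            prob p (QOutside ends (↑P : Set V) a₁ a₂) *
              ∑ W₂ : Finset V,
                prob p {ω | ¬ Conn ends (restrict (touches ends (↑P : Set V))ᶜ ω) a₂ a₁ ∧
                  cluster ends (restrict (touches ends (↑P : Set V))ᶜ ω) a₁ = (↑W₂ : Set V)} *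
                  outTermT p ends P W₂ o a₂ b)) := by
  have hP' := hP.symm
  -- the masses
  have hQ := prob_avoidAll_pocket p hP h1 h2
  have hPD := prob_PDEvent_pocket p hP h1 h2 h3
  have hPDo1 := prob_PDEvent_inter_conn p hP h1 h2 h3 h1 ho
  have hPDo2 := prob_PDEvent_inter_conn p hP h1 h2 h3 h2 ho
  have hM2 := massM2_pocket p hP h1 h2 h3 hb
  have hΔ := deltaT_pocket p hP h1 h2 h3 hb
  have hgap := gap_pocket p hP h1 h2 hb
  have hX := Xhat_pocket p hP h12 h1 h2 ho hb h3
  rw [pi_comm (a₁ := a₁) (a₂ := a₂) (a₃ := a₃)] at hX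
  -- the margin: EQo, EQ3, EQ3o
  have hEQo : CovForm.EQo p ends o a₁ a₂ =
      prob p (QPocket ends (↑P : Set V) a₁ a₂) *
        (outMass p ends P a₁ a₂ a₁ o - outMass p ends P a₁ a₂ a₂ o) := by
    rw [CovForm.EQo, avoidAll_eq_compl_connEvent, prob_Q_inter_conn p hP h1 h2 h1 ho,
      prob_Q_inter_conn p hP h1 h2 h2 ho, mul_sub]
  have hT := prob_TEvent_pocket p hP h1 h2 h3
  have hT' := prob_TEvent_pocket p hP' h2 h1 h3
  rw [pi_comm (a₁ := a₁) (a₂ := a₂) (a₃ := a₃), QOutside_comm (a₁ := a₁) (a₂ := a₂)] at hT'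
  have hEQ3 : CovForm.EQ3 p ends a₁ a₂ a₃ =
      (prob p {ω | ¬ Conn ends (restrict (touches ends (↑P : Set V)) ω) a₁ a₂ ∧
          Conn ends (restrict (touches ends (↑P : Set V)) ω) a₃ a₁} -
        prob p {ω | ¬ Conn ends (restrict (touches ends (↑P : Set V)) ω) a₁ a₂ ∧
          Conn ends (restrict (touches ends (↑P : Set V)) ω) a₃ a₂}) *
        prob p (QOutside ends (↑P : Set V) a₁ a₂) := by
    rw [CovForm.EQ3, hT, hT', sub_mul]
  have hTo1 := prob_conn_inter_TEvent p hP h1 h2 h3 h1 ho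
  have hTo2 := prob_conn_inter_TEvent p hP h1 h2 h3 h2 ho
  have hT'o1 := prob_conn_inter_TEvent p hP' h2 h1 h3 h1 ho
  have hT'o2 := prob_conn_inter_TEvent p hP' h2 h1 h3 h2 ho
  rw [pi_comm (a₁ := a₁) (a₂ := a₂) (a₃ := a₃), outMass_comm (a₁ := a₁) (a₂ := a₂)] at hT'o1 hT'o2
  have hEQ3o : CovForm.EQ3o p ends o a₁ a₂ a₃ =
      (prob p {ω | ¬ Conn ends (restrict (touches ends (↑P : Set V)) ω) a₁ a₂ ∧
          Conn ends (restrict (touches ends (↑P : Set V)) ω) a₃ a₁} -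
        prob p {ω | ¬ Conn ends (restrict (touches ends (↑P : Set V)) ω) a₁ a₂ ∧
          Conn ends (restrict (touches ends (↑P : Set V)) ω) a₃ a₂}) *
        (outMass p ends P a₁ a₂ a₁ o + outMass p ends P a₁ a₂ a₂ o) := by
    rw [CovForm.EQ3o, Set.inter_comm (TEvent ends a₂ a₁ a₃), Set.inter_comm (TEvent ends a₂ a₁ a₃),
      Set.inter_comm (TEvent ends a₁ a₂ a₃), Set.inter_comm (TEvent ends a₁ a₂ a₃), hTo1, hTo2,
      hT'o1, hT'o2]
    ring
  have hsplit := prob_QPocket_split (ends := ends) (P := P) (a₁ := a₁) (a₂ := a₂) (a₃ := a₃) p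
  -- substitute
  rw [HMFc, CovForm.marginC, CovForm.DEF, CovForm.Do, hQ, hPD, hPDo1, hPDo2, hM2, hΔ, hgap, hX,
    hEQo, hEQ3, hEQ3o, hsplit]
  by_cases hZ : prob p (QOutside ends (↑P : Set V) a₁ a₂) = 0
  · -- `Z₁ = 0`: every outside mass vanishes and both sides are `0`
    have hm : ∀ x v, outMass p ends P a₁ a₂ x v = 0 := by
      intro x v
      refine le_antisymm ?_ (prob_nonneg hp _)
      rw [← hZ]
      exact prob_mono hp Set.inter_subset_left
    simp [hm, hZ]
  · field_simp
    ring

/-- **(HMF) in a root-only pocket, modulo the two outside BHK brackets.**  If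
`β₂ = A_L¹ (B_H¹ − B_L¹) − Z₁ Y_T ≥ 0` and `β₁ = −A_H¹ (B_H¹ − B_L¹) − Z₁ Y_T′ ≥ 0` (the cross- and
same-cluster BHK inequalities on the outside graph `G₁`), then `(HMF)` holds. -/
theorem HMF_pocket_of_beta (p : E → R) (hp : IsProbVec p) (hP : IsPocket ends (↑P : Set V) a₁ a₂)
    (h12 : a₁ ≠ a₂) (h1 : a₁ ∉ P) (h2 : a₂ ∉ P) {o b : V} (ho : o ∉ P) (hb : b ∉ P)
    (h3 : a₃ ∈ P)
    (hβ₂ : 0 ≤ outMass p ends P a₁ a₂ a₁ o *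
        (outMass p ends P a₁ a₂ a₂ b - outMass p ends P a₁ a₂ a₁ b) -
      prob p (QOutside ends (↑P : Set V) a₁ a₂) *
        ∑ W₂ : Finset V,
          prob p {ω | ¬ Conn ends (restrict (touches ends (↑P : Set V))ᶜ ω) a₁ a₂ ∧
            cluster ends (restrict (touches ends (↑P : Set V))ᶜ ω) a₂ = (↑W₂ : Set V)} *
            outTermT p ends P W₂ o a₁ b)
    (hβ₁ : 0 ≤ -(outMass p ends P a₁ a₂ a₂ o *
        (outMass p ends P a₁ a₂ a₂ b - outMass p ends P a₁ a₂ a₁ b)) -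
      prob p (QOutside ends (↑P : Set V) a₁ a₂) *
        ∑ W₂ : Finset V,
          prob p {ω | ¬ Conn ends (restrict (touches ends (↑P : Set V))ᶜ ω) a₂ a₁ ∧
            cluster ends (restrict (touches ends (↑P : Set V))ᶜ ω) a₁ = (↑W₂ : Set V)} *
            outTermT p ends P W₂ o a₂ b) :
    HMF p ends o a₁ a₂ a₃ b := by
  rw [HMF, HMFc_pocket p hp hP h12 h1 h2 ho hb h3]
  refine mul_nonneg (mul_nonneg (mul_nonneg (mul_nonneg (by norm_num) (prob_nonneg hp _))
    (prob_nonneg hp _)) (prob_nonneg hp _)) ?_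
  exact add_nonneg (mul_nonneg (prob_nonneg hp _) hβ₂) (mul_nonneg (prob_nonneg hp _) hβ₁)

/-- **(HCOV) in a root-only pocket, modulo the two outside BHK brackets.** -/
theorem HCov_pocket_of_beta (p : E → R) (hp : IsProbVec p) (hP : IsPocket ends (↑P : Set V) a₁ a₂)
    (h12 : a₁ ≠ a₂) (h1 : a₁ ∉ P) (h2 : a₂ ∉ P) {o b : V} (ho : o ∉ P) (hb : b ∉ P)
    (h3 : a₃ ∈ P)
    (hβ₂ : 0 ≤ outMass p ends P a₁ a₂ a₁ o *
        (outMass p ends P a₁ a₂ a₂ b - outMass p ends P a₁ a₂ a₁ b) -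
      prob p (QOutside ends (↑P : Set V) a₁ a₂) *
        ∑ W₂ : Finset V,
          prob p {ω | ¬ Conn ends (restrict (touches ends (↑P : Set V))ᶜ ω) a₁ a₂ ∧
            cluster ends (restrict (touches ends (↑P : Set V))ᶜ ω) a₂ = (↑W₂ : Set V)} *
            outTermT p ends P W₂ o a₁ b)
    (hβ₁ : 0 ≤ -(outMass p ends P a₁ a₂ a₂ o *
        (outMass p ends P a₁ a₂ a₂ b - outMass p ends P a₁ a₂ a₁ b)) -
      prob p (QOutside ends (↑P : Set V) a₁ a₂) *
        ∑ W₂ : Finset V,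
          prob p {ω | ¬ Conn ends (restrict (touches ends (↑P : Set V))ᶜ ω) a₂ a₁ ∧
            cluster ends (restrict (touches ends (↑P : Set V))ᶜ ω) a₁ = (↑W₂ : Set V)} *
            outTermT p ends P W₂ o a₂ b) :
    CovForm.HCov p ends o a₁ a₂ a₃ b :=
  HCov_of_HMF p hp ends o a₁ a₂ a₃ b (HMF_pocket_of_beta p hp hP h12 h1 h2 ho hb h3 hβ₂ hβ₁)

end Field

end PocketConn

end Summit.Ventures.PercRepro2
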